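import Literature.Analysis.Hypoelliptic.HormanderProof
import HarnessLib

/-!
# The named fact `Hormander1967_thm11` is discharged by `hormander1967_thm11_proof`

Sibling file of `Literature/Analysis/Distribution/Hypoelliptic.lean`. The named fact
`Literature.Analysis.Distribution.Hormander1967_thm11` (L. Hörmander, *Hypoelliptic second order
differential equations*, Acta Math. 119 (1967), Theorem 1.1: sums of squares of
bracket-generating vector fields plus a first-order term are hypoelliptic) is PROVED in the tree:
the theorem `Literature.Analysis.Hypoelliptic.hormander1967_thm11_proof` of
`Literature/Analysis/Hypoelliptic/HormanderProof.lean` (Kohn's Fourier-side method as presented in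
M. E. Taylor, *Pseudodifferential Operators* (1981), Ch. XV §1, assembled from the toolkit
`Literature/Analysis/Hypoelliptic/*`) has exactly the statement `Hormander1967_thm11`, so it IS
the discharge of the fact — use it directly and import
`Literature.Analysis.Hypoelliptic.HormanderProof`. The `example` below machine-checks this
without declaring a second constant.

The conventional discharge name `Hormander1967_thm11_holds` is kept resolvable only as a
deprecated alias of `hormander1967_thm11_proof` (dedup item dedup-00578, 2026-08-15: the former
one-line theorem `Hormander1967_thm11_holds := hormander1967_thm11_proof` declared the same
statement a second time; its one user, `LangevinSemigroupProofs.lean`, now uses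
`hormander1967_thm11_proof`). No module of the tree imports this file.

## References

* L. Hörmander, Acta Math. 119 (1967), 147–171, Thm 1.1.
* M. E. Taylor, *Pseudodifferential Operators*, Princeton Univ. Press (1981), Ch. XV §1.
-/

namespace Literature.Analysis.Distribution

/-- **Hörmander's theorem holds**: `hormander1967_thm11_proof` has exactly the statement of the
named fact `Hormander1967_thm11` (machine-checked pointer; an `example` declares nothing).
[cite: Hormander1967, Thm 1.1] -/
example : Hormander1967_thm11 := Literature.Analysis.Hypoelliptic.hormander1967_thm11_proof

/-- Deprecated alias (dedup-00578): the discharge of the named fact `Hormander1967_thm11` is the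
theorem `Literature.Analysis.Hypoelliptic.hormander1967_thm11_proof` — use that name.
[cite: Hormander1967, Thm 1.1] -/
@[deprecated Literature.Analysis.Hypoelliptic.hormander1967_thm11_proof (since := "2026-08-15")]
alias Hormander1967_thm11_holds := Literature.Analysis.Hypoelliptic.hormander1967_thm11_proof

end Literature.Analysis.Distribution
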